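import Mathlib
import Summits.Ventures.PercRepro2.MixChordLaw

/-!
# The parallel-edge (doubling) lemma: a second copy of an edge is the edge at the combined weight,
and a step of the monotone LAW is a CHORD of the doubled instance (blind cell PercRepro2, night-1 g21;
proofs/NIGHT1-G21.md §4)

Adjoin to the edge `e` a parallel copy `none` (`endsP`: the copy has the ends of `e`) of weight `r`,
and give `e` the weight `q₁` (`pP`).  The merge `Ψ` of a configuration of the doubled graph opens `e`
iff `e` or its copy is open; it preserves every connection (`conn_parallel`: the open graphs coincide)
and pushes the product law forward onto the product law with `e` at the combined weight
`q₂ = 1 − (1 − q₁)(1 − r)` (`prob_parallel`).  Hence every mass of `Gc` transports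
(`Gc_parallel`: `Gc` of the doubled instance is `Gc (p[e ↦ q₂])`), the normalisers `D`, `D·Z`,
`(D·Z)²` transport (`normD_parallel`, …), and the mixed chord with normaliser `N` along the copy in
the doubled instance is exactly the step `q₁ → q₂` of the monotone law `NLaw N` at a COINCIDENCE edge
(`Gc (p[e ↦ 1]) = 0`) — `nLaw_step_of_nMixChord_parallel`; so the law along every coincidence root
edge follows from the chord on all instances (`nLaw_of_nMixChord_all_aux`).  This is the doubling lemma
of NIGHT1-G20.md §6 in the kernel: a failure of the law is a failure of the chord one vertex up.

Own code; standard axioms.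
-/

namespace Summit.Ventures.PercRepro2

open UnionCluster CovForm

namespace ParallelEdge

section Defs

variable {V : Type*} {E : Type*} [DecidableEq E]

/-- The graph with a parallel copy `none` of the edge `e` adjoined. -/
def endsP (ends : E → Sym2 V) (e : E) : Option E → Sym2 V := fun g => g.elim (ends e) ends

/-- The weights of the doubled instance: `r` on the copy, `q₁` on `e`, the rest unchanged. -/
def pP {R : Type*} (p : E → R) (e : E) (q₁ r : R) : Option E → R :=
  fun g => g.elim r (Function.update p e q₁)

/-- The merge of a configuration of the doubled graph: `e` is open iff `e` or its copy is open. -/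
def Ψ (e : E) (ω' : Config (Option E)) : Config E :=
  Function.update (fun g => ω' (some g)) e (ω' (some e) || ω' none)

/-- The lift of a configuration with a prescribed state `b` of the copy. -/
def lift (b : Bool) (ω : Config E) : Config (Option E) := fun g => g.elim b ω

omit [DecidableEq E] in
/-- The copy has the ends of `e`. -/
@[simp] lemma endsP_none (ends : E → Sym2 V) (e : E) : endsP ends e none = ends e := rfl

omit [DecidableEq E] in
/-- The old edges keep their ends. -/
@[simp] lemma endsP_some (ends : E → Sym2 V) (e g : E) : endsP ends e (some g) = ends g := rfl

/-- The copy has weight `r`. -/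
@[simp] lemma pP_none {R : Type*} (p : E → R) (e : E) (q₁ r : R) : pP p e q₁ r none = r := rfl

/-- The old edges have the weights of `p[e ↦ q₁]`. -/
@[simp] lemma pP_some {R : Type*} (p : E → R) (e g : E) (q₁ r : R) :
    pP p e q₁ r (some g) = Function.update p e q₁ g := rfl

/-- In the merge, `e` is open iff `e` or its copy is open. -/
@[simp] lemma Ψ_self (e : E) (ω' : Config (Option E)) : Ψ e ω' e = (ω' (some e) || ω' none) :=
  Function.update_self _ _ _

/-- The merge keeps the state of every other edge. -/
lemma Ψ_of_ne (e : E) (ω' : Config (Option E)) {g : E} (h : g ≠ e) : Ψ e ω' g = ω' (some g) :=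
  Function.update_of_ne h _ _

omit [DecidableEq E] in
/-- The state of the copy in a lift. -/
@[simp] lemma lift_none (b : Bool) (ω : Config E) : lift b ω none = b := rfl

omit [DecidableEq E] in
/-- The states of the old edges in a lift. -/
@[simp] lemma lift_some (b : Bool) (ω : Config E) (g : E) : lift b ω (some g) = ω g := rfl

/-- The merge of a lift: `e` is forced open when the copy is. -/
lemma Ψ_lift (e : E) (b : Bool) (ω : Config E) :
    Ψ e (lift b ω) = Function.update ω e (ω e || b) := by
  funext g
  by_cases h : g = e
  · subst h; simp [Ψ]
  · rw [Ψ_of_ne e _ h, Function.update_of_ne h, lift_some]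

/-- The merge of a lift with the copy open. -/
lemma Ψ_lift_true (e : E) (ω : Config E) : Ψ e (lift true ω) = Function.update ω e true := by
  rw [Ψ_lift, Bool.or_true]

/-- The merge of a lift with the copy closed. -/
lemma Ψ_lift_false (e : E) (ω : Config E) : Ψ e (lift false ω) = ω := by
  rw [Ψ_lift, Bool.or_false, Function.update_eq_self]

omit [DecidableEq E] in
/-- Every configuration of the doubled graph is the lift of its restriction. -/
lemma lift_eq (ω' : Config (Option E)) : lift (ω' none) (fun g => ω' (some g)) = ω' := by
  funext g; cases g <;> rfl

end Defs

section Prob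

variable {E : Type*} [Fintype E] [DecidableEq E] {R : Type*} [CommRing R]

/-- The weight of the doubled instance factorises over the copy. -/
lemma weight_pP (p : E → R) (e : E) (q₁ r : R) (b : Bool) (ω : Config E) :
    weight (pP p e q₁ r) (lift b ω) = edgeFactor r b * weight (Function.update p e q₁) ω := by
  unfold weight
  rw [Fintype.prod_option]
  rfl

/-- Sums over the doubled configuration space split along the state of the copy. -/
lemma sum_option_config (F : Config (Option E) → R) :
    ∑ ω', F ω' = ∑ ω : Config E, (F (lift true ω) + F (lift false ω)) := by
  have key : ∑ ω', F ω' = ∑ x : Bool × Config E, F (lift x.1 x.2) := by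
    refine Fintype.sum_equiv (Equiv.piOptionEquivProd (β := fun _ : Option E => Bool)) _ _
      fun ω' => ?_
    show F ω' = F (lift (ω' none) (fun g => ω' (some g)))
    rw [lift_eq]
  rw [key, Fintype.sum_prod_type, Fintype.sum_bool, ← Finset.sum_add_distrib]

/-- The expectation under the doubled instance, marginalised over the copy. -/
lemma expect_pP (p : E → R) (e : E) (q₁ r : R) (F : Config (Option E) → R) :
    expect (pP p e q₁ r) F =
      r * expect (Function.update p e q₁) (fun ω => F (lift true ω)) +
        (1 - r) * expect (Function.update p e q₁) (fun ω => F (lift false ω)) := by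
  unfold expect
  rw [sum_option_config (fun ω' => weight (pP p e q₁ r) ω' * F ω')]
  rw [Finset.mul_sum, Finset.mul_sum, ← Finset.sum_add_distrib]
  refine Finset.sum_congr rfl fun ω _ => ?_
  rw [weight_pP, weight_pP]
  simp only [edgeFactor_true, edgeFactor_false]
  ring

/-- **The pushforward identity**: the merge `Ψ` carries the doubled instance to the instance with `e`
at the combined weight `1 − (1 − q₁)(1 − r)`. -/
theorem prob_parallel (p : E → R) (e : E) (q₁ r : R) (A : Set (Config E)) :
    prob (pP p e q₁ r) (Ψ e ⁻¹' A) = prob (Function.update p e (1 - (1 - q₁) * (1 - r))) A := by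
  classical
  rw [prob_eq_expect_indicator, expect_pP]
  have h1 : (fun ω : Config E => (Ψ e ⁻¹' A).indicator (1 : Config (Option E) → R) (lift true ω)) =
      fun ω => A.indicator 1 (Function.update ω e true) := by
    funext ω
    rw [Set.indicator_apply, Set.indicator_apply, Set.mem_preimage, Ψ_lift_true]
    rfl
  have h0 : (fun ω : Config E => (Ψ e ⁻¹' A).indicator (1 : Config (Option E) → R) (lift false ω)) =
      fun ω => A.indicator 1 ω := by
    funext ω
    rw [Set.indicator_apply, Set.indicator_apply, Set.mem_preimage, Ψ_lift_false]
    rfl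
  rw [h1, h0, ← expect_update_one, Function.update_idem, ← prob_eq_expect_indicator,
    ← prob_eq_expect_indicator]
  rw [prob_eq_pin (Function.update p e q₁) A e,
    prob_eq_pin (Function.update p e (1 - (1 - q₁) * (1 - r))) A e]
  simp only [Function.update_idem, Function.update_self]
  ring

end Prob

section Conn

variable {V : Type*} {E : Type*} [DecidableEq E] {ends : E → Sym2 V} {e : E}

/-- The open adjacencies of the merge are those of the doubled configuration. -/
lemma openAdj_Ψ (ω' : Config (Option E)) (a b : V) :
    OpenAdj ends (Ψ e ω') a b ↔ OpenAdj (endsP ends e) ω' a b := by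
  constructor
  · rintro ⟨g, hg, hends⟩
    by_cases h : g = e
    · subst h
      rw [Ψ_self] at hg
      rcases Bool.or_eq_true_iff.1 hg with h' | h'
      · exact ⟨some g, h', hends⟩
      · exact ⟨none, h', hends⟩
    · rw [Ψ_of_ne e ω' h] at hg
      exact ⟨some g, hg, hends⟩
  · rintro ⟨g, hg, hends⟩
    cases g with
    | none =>
      refine ⟨e, ?_, hends⟩
      rw [Ψ_self, hg, Bool.or_true]
    | some g =>
      by_cases h : g = e
      · subst h
        refine ⟨g, ?_, hends⟩
        rw [Ψ_self, hg, Bool.true_or]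
      · exact ⟨g, by rw [Ψ_of_ne e ω' h]; exact hg, hends⟩

/-- The open graph of the merge is the open graph of the doubled configuration. -/
lemma openGraph_Ψ (ω' : Config (Option E)) :
    openGraph ends (Ψ e ω') = openGraph (endsP ends e) ω' := by
  ext a b
  rw [openGraph_adj, openGraph_adj, openAdj_Ψ]

/-- **Connections transport**: `a ↔ b` in the doubled configuration iff in its merge. -/
theorem conn_parallel (ω' : Config (Option E)) (a b : V) :
    Conn (endsP ends e) ω' a b ↔ Conn ends (Ψ e ω') a b := by
  unfold Conn
  rw [openGraph_Ψ]

/-- The connection event of the doubled graph is the preimage of the connection event. -/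
lemma connEvent_parallel (a b : V) :
    connEvent (endsP ends e) a b = Ψ e ⁻¹' connEvent ends a b := by
  ext ω'
  exact conn_parallel ω' a b

/-- The avoidance event of the doubled graph is a preimage. -/
lemma avoidAll_parallel (s : V) (X : Finset V) :
    avoidAll (endsP ends e) s X = Ψ e ⁻¹' avoidAll ends s X := by
  ext ω'
  simp only [avoidAll, Set.mem_setOf_eq, Set.mem_preimage, conn_parallel]

/-- `PD` of the doubled graph is a preimage. -/
lemma PDEvent_parallel (a₁ a₂ a₃ : V) :
    PDEvent (endsP ends e) a₁ a₂ a₃ = Ψ e ⁻¹' PDEvent ends a₁ a₂ a₃ := by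
  ext ω'
  simp only [PDEvent, Dtilde, UnionCluster.inU, Set.mem_preimage, Set.mem_inter_iff,
    Set.mem_compl_iff, Set.mem_union, mem_connEvent, conn_parallel]

/-- `T` of the doubled graph is a preimage. -/
lemma TEvent_parallel (a₁ a₂ a₃ : V) :
    TEvent (endsP ends e) a₁ a₂ a₃ = Ψ e ⁻¹' TEvent ends a₁ a₂ a₃ := by
  ext ω'
  simp only [TEvent, Set.mem_preimage, Set.mem_inter_iff, Set.mem_compl_iff, mem_connEvent,
    conn_parallel]

end Conn

section Gc

variable {V : Type*} {E : Type*} [Fintype E] [DecidableEq E] {R : Type*} [Field R]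

variable (p : E → R) (ends : E → Sym2 V) (e : E) (q₁ r : R) (o a₁ a₂ a₃ b : V)

/-- **`Gc` transports**: the covariance form of the doubled instance is the covariance form of
the instance with `e` at the combined weight. -/
theorem Gc_parallel :
    Gc (pP p e q₁ r) (endsP ends e) o a₁ a₂ a₃ b =
      Gc (Function.update p e (1 - (1 - q₁) * (1 - r))) ends o a₁ a₂ a₃ b := by
  unfold Gc DEF EQbo EQb3 EQb3o EQo EQ3 EQ3o PDb PDbo Do gap
  simp only [connEvent_parallel, avoidAll_parallel, PDEvent_parallel, TEvent_parallel,
    ← Set.preimage_inter, prob_parallel]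

/-- The `PD`-mass transports. -/
theorem normD_parallel :
    Mix.normD (endsP ends e) a₁ a₂ a₃ (pP p e q₁ r) =
      Mix.normD ends a₁ a₂ a₃ (Function.update p e (1 - (1 - q₁) * (1 - r))) := by
  unfold Mix.normD
  rw [PDEvent_parallel, prob_parallel]

/-- The `D·Z`-normaliser transports. -/
theorem normDZ_parallel :
    Mix.normDZ (endsP ends e) a₁ a₂ a₃ (pP p e q₁ r) =
      Mix.normDZ ends a₁ a₂ a₃ (Function.update p e (1 - (1 - q₁) * (1 - r))) := by
  unfold Mix.normDZ
  rw [PDEvent_parallel, avoidAll_parallel, prob_parallel, prob_parallel]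

/-- The `(D·Z)²`-normaliser transports. -/
theorem normDZ2_parallel :
    Mix.normDZ2 (endsP ends e) a₁ a₂ a₃ (pP p e q₁ r) =
      Mix.normDZ2 ends a₁ a₂ a₃ (Function.update p e (1 - (1 - q₁) * (1 - r))) := by
  unfold Mix.normDZ2
  rw [PDEvent_parallel, avoidAll_parallel, prob_parallel, prob_parallel]

end Gc

section Law

variable {V : Type*} {E : Type*} [DecidableEq E] {R : Type*}

/-- Pinning the copy closed. -/
lemma pP_update_none_zero [Zero R] (p : E → R) (e : E) (q₁ r : R) :
    Function.update (pP p e q₁ r) none 0 = pP p e q₁ 0 := by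
  funext g; cases g <;> simp [pP]

/-- Pinning the copy open. -/
lemma pP_update_none_one [One R] (p : E → R) (e : E) (q₁ r : R) :
    Function.update (pP p e q₁ r) none 1 = pP p e q₁ 1 := by
  funext g; cases g <;> simp [pP]

variable [Fintype E] [Field R] [LinearOrder R] [IsStrictOrderedRing R]
  {p : E → R} {ends : E → Sym2 V} {e : E} {o a₁ a₂ a₃ b : V}

/-- **A chord of the doubled instance is a law step.**  For normalisers `N'` (doubled instance)
and `N` that correspond (`hN`), the mixed chord with normaliser `N'` along the copy — weights `q₁` on
`e`, `r` on the copy — is the step `q₁ → q₂ = 1 − (1 − q₁)(1 − r)` of the monotone law `NLaw N`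
at a coincidence edge (`Gc (p[e ↦ 1]) = 0`). -/
theorem nLaw_step_of_nMixChord_parallel (N' : (Option E → R) → R) (N : (E → R) → R)
    (hN : ∀ q s : R, N' (pP p e q s) = N (Function.update p e (1 - (1 - q) * (1 - s))))
    (hG1 : Gc (Function.update p e 1) ends o a₁ a₂ a₃ b = 0) {q₁ r : R} (hq₁ : q₁ ≤ 1)
    (h : Mix.NMixChord N' (pP p e q₁ r) (endsP ends e) o a₁ a₂ a₃ b none) :
    (Gc (Function.update p e q₁) ends o a₁ a₂ a₃ b -
        q₁ * Gc (Function.update p e 1) ends o a₁ a₂ a₃ b) *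
      ((1 - (1 - (1 - q₁) * (1 - r))) * N (Function.update p e (1 - (1 - q₁) * (1 - r)))) ≤
    (Gc (Function.update p e (1 - (1 - q₁) * (1 - r))) ends o a₁ a₂ a₃ b -
        (1 - (1 - q₁) * (1 - r)) * Gc (Function.update p e 1) ends o a₁ a₂ a₃ b) *
      ((1 - q₁) * N (Function.update p e q₁)) := by
  unfold Mix.NMixChord at h
  rw [pP_update_none_zero, pP_update_none_one, pP_none, Gc_parallel, Gc_parallel, Gc_parallel, hN,
    hN] at h
  have e0 : (1 - (1 - q₁) * (1 - 0) : R) = q₁ := by ring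
  have e1 : (1 - (1 - q₁) * (1 - 1) : R) = 1 := by ring
  rw [e0, e1, hG1] at h
  rw [hG1]
  have h1q : 0 ≤ 1 - q₁ := sub_nonneg.2 hq₁
  have := mul_le_mul_of_nonneg_left h h1q
  simp only [mul_zero, sub_zero] at this ⊢
  linear_combination this

/-- **The law from the chords of the doubled instances** (the doubling lemma): at a coincidence edge
`e` (`Gc (p[e ↦ 1]) = 0`), if the mixed chord with the (corresponding) normaliser holds along the copy
in every doubled instance (`e` at any weight `q₁ ∈ [0, 1]`, the copy at any weight `r ∈ [0, 1]`), then
the monotone law `NLaw N` holds along `e`. -/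
theorem nLaw_of_nMixChord_parallel (N' : (Option E → R) → R) (N : (E → R) → R)
    (hN : ∀ q s : R, N' (pP p e q s) = N (Function.update p e (1 - (1 - q) * (1 - s))))
    (hG1 : Gc (Function.update p e 1) ends o a₁ a₂ a₃ b = 0)
    (h : ∀ q₁ r : R, 0 ≤ q₁ → q₁ ≤ 1 → 0 ≤ r → r ≤ 1 →
      Mix.NMixChord N' (pP p e q₁ r) (endsP ends e) o a₁ a₂ a₃ b none) :
    Mix.NLaw N p ends o a₁ a₂ a₃ b e := by
  intro q₁ q₂ hq₁ hq₁₂ hq₂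
  by_cases hq : q₁ = 1
  · -- `q₁ = q₂ = 1`: both sides vanish
    have hq2 : q₂ = 1 := le_antisymm hq₂ (hq ▸ hq₁₂)
    rw [hq, hq2]
  · have hlt : q₁ < 1 := lt_of_le_of_ne (le_trans hq₁₂ hq₂) hq
    have hpos : 0 < 1 - q₁ := sub_pos.2 hlt
    set r : R := (q₂ - q₁) / (1 - q₁) with hr
    have hr0 : 0 ≤ r := div_nonneg (sub_nonneg.2 hq₁₂) hpos.le
    have hr1 : r ≤ 1 := by
      rw [hr, div_le_one hpos]
      linarith
    have hne : (1 - q₁ : R) ≠ 0 := hpos.ne'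
    have hmul : (1 - q₁) * r = q₂ - q₁ := by
      rw [hr, mul_comm, div_mul_cancel₀ _ hne]
    have hq2 : 1 - (1 - q₁) * (1 - r) = q₂ := by linear_combination hmul
    have key := nLaw_step_of_nMixChord_parallel N' N hN hG1 hlt.le
      (h q₁ r hq₁ hlt.le hr0 hr1)
    rw [hq2] at key
    exact key

/-- The doubling lemma for the `D`-normaliser. -/
theorem nLaw_normD_of_nMixChord_parallel
    (hG1 : Gc (Function.update p e 1) ends o a₁ a₂ a₃ b = 0)
    (h : ∀ q₁ r : R, 0 ≤ q₁ → q₁ ≤ 1 → 0 ≤ r → r ≤ 1 →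
      Mix.NMixChord (Mix.normD (endsP ends e) a₁ a₂ a₃) (pP p e q₁ r) (endsP ends e) o a₁ a₂ a₃ b
        none) :
    Mix.NLaw (Mix.normD ends a₁ a₂ a₃) p ends o a₁ a₂ a₃ b e :=
  nLaw_of_nMixChord_parallel _ _ (fun q s => normD_parallel p ends e q s a₁ a₂ a₃) hG1 h

/-- The doubling lemma for the `D·Z`-normaliser. -/
theorem nLaw_normDZ_of_nMixChord_parallel
    (hG1 : Gc (Function.update p e 1) ends o a₁ a₂ a₃ b = 0)
    (h : ∀ q₁ r : R, 0 ≤ q₁ → q₁ ≤ 1 → 0 ≤ r → r ≤ 1 →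
      Mix.NMixChord (Mix.normDZ (endsP ends e) a₁ a₂ a₃) (pP p e q₁ r) (endsP ends e) o a₁ a₂ a₃ b
        none) :
    Mix.NLaw (Mix.normDZ ends a₁ a₂ a₃) p ends o a₁ a₂ a₃ b e :=
  nLaw_of_nMixChord_parallel _ _ (fun q s => normDZ_parallel p ends e q s a₁ a₂ a₃) hG1 h

/-- The doubling lemma for the `(D·Z)²`-normaliser. -/
theorem nLaw_normDZ2_of_nMixChord_parallel
    (hG1 : Gc (Function.update p e 1) ends o a₁ a₂ a₃ b = 0)
    (h : ∀ q₁ r : R, 0 ≤ q₁ → q₁ ≤ 1 → 0 ≤ r → r ≤ 1 →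
      Mix.NMixChord (Mix.normDZ2 (endsP ends e) a₁ a₂ a₃) (pP p e q₁ r) (endsP ends e) o a₁ a₂ a₃ b
        none) :
    Mix.NLaw (Mix.normDZ2 ends a₁ a₂ a₃) p ends o a₁ a₂ a₃ b e :=
  nLaw_of_nMixChord_parallel _ _ (fun q s => normDZ2_parallel p ends e q s a₁ a₂ a₃) hG1 h

end Law

end ParallelEdge

end Summit.Ventures.PercRepro2
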